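import Mathlib.AlgebraicGeometry.EllipticCurve.Affine.Point
import HarnessLib

/-!
# Vélu's `2`-isogeny with kernel a `2`-TORSION point `Q = (e, f)`, general Weierstrass equation (`a₁, a₃` arbitrary):
# the image point lies on Vélu's curve, and the invariant differential is preserved (affine identities, any commutative ring)

Cell `bsd-f1-sign2`, WIDTH-5 attach seat `bsd-line-att-p3` g8 (`--supports stmt-BirchSwinnertonDyer-23008`; discharge plan
`Cruxes/BSDOfMainConjectureRankOneAtTwo/SIGMASQ-AT-TWO-att-p3.md`, step S3/S4: the quotient `E → E/μ₂` by the `ℚ₂`-rational canonical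
subgroup at an ordinary `2`, where `a₁` is a unit and the tree's two-torsion-normal-form isogeny `IsogenyTwoTorsionProofs`
(`a₁ = a₃ = 0`, kernel `(0,0)`) is not available integrally). THEOREMS ONLY, over an arbitrary commutative ring; route-independent
(imports Mathlib only). BSD is not proved by any of this.

Vélu (1971) for `W : y² + a₁xy + a₃y = x³ + a₂x² + a₄x + a₆` and a `2`-torsion point `Q = (e, f)` (`2f + a₁e + a₃ = 0`):
`t = 3e² + 2a₂e + a₄ − a₁f` (`= g^x_Q`; `u_Q = 0`), `w = et`, the quotient curve
`W' : A₁ = a₁, A₂ = a₂, A₃ = a₃, A₄ = a₄ − 5t, A₆ = a₆ − b₂t − 7et` and the isogeny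
`ψ(x, y) = (x + t/(x − e), y − t·(a₁(x − e) + y − f)/(x − e)²)`, with `ψ*(dx'/(2y' + a₁x' + a₃)) = dx/(2y + a₁x + a₃)`.

* `velu_two_equation_cleared` — **the image point lies on `W'`**, stated with the poles cleared by `(x − e)⁶` (an identity in any
  commutative ring, certified by `linear_combination` with an integral certificate found by elimination:
  `Φ = α·(eqn of (x,y)) + c_t·(def of t) + c₂·(2f + a₁e + a₃) + c₆·(eqn of (e,f))`);
* `velu_two_negY_cleared` — **`2y' + a₁x' + a₃ = (1 − t/(x − e)²)·(2y + a₁x + a₃)`** cleared (uses only `2f + a₁e + a₃ = 0`); with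
  `dx' = (1 − t/(x − e)²)dx` this is Vélu's normalisation `ψ*ω' = ω`;
* `velu_two_equation` — over a field, the `Affine.Equation` form at `x ≠ e`.

## Sources
* J. Vélu, *Isogénies entre courbes elliptiques*, C. R. Acad. Sci. Paris 273 (1971) 238–241 (the formulas for `t_Q, u_Q, w`, `A₄, A₆`
  and `(X, Y)`, case `Q ∈ F₂`). [cite: SilvermanAEC2009, III.4 Example 4.5 and Exercise 3.35]
* L. C. Washington, *Elliptic Curves*, 2nd ed., Thm. 12.16 (Vélu's formulae, general Weierstrass form). [cite: SilvermanAEC2009, III.4]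
-/

set_option linter.dupNamespace false
set_option autoImplicit false

namespace Summit.BirchSwinnertonDyer.BirchSwinnertonDyer.Theorems.AlignedTransportAtTwoSigmaSqTwo

variable {R : Type*} [CommRing R] (W : WeierstrassCurve R)

/-- **Vélu's `2`-isogeny, the image point lies on the quotient curve (poles cleared by `(x − e)⁶`).** For `(x, y)` on `W`,
`Q = (e, f)` on `W` with `2f + a₁e + a₃ = 0`, `t = 3e² + 2a₂e + a₄ − a₁f`, and `P₁ = (x−e)·x' = (x−e)² + e(x−e) + t`,
`P₂ = (x−e)²·y' = y(x−e)² − t(a₁(x−e) + y − f)`: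
`P₂²(x−e)² + a₁P₁P₂(x−e)³ + a₃P₂(x−e)⁴ = P₁³(x−e)³ + a₂P₁²(x−e)⁴ + (a₄ − 5t)P₁(x−e)⁵ + (a₆ − (a₁² + 4a₂)t − 7et)(x−e)⁶`.
[cite: SilvermanAEC2009, III.4 Example 4.5 and Exercise 3.35] -/
theorem velu_two_equation_cleared {x y e f t : R}
    (hW : y ^ 2 + W.a₁ * x * y + W.a₃ * y = x ^ 3 + W.a₂ * x ^ 2 + W.a₄ * x + W.a₆)
    (hQ : f ^ 2 + W.a₁ * e * f + W.a₃ * f = e ^ 3 + W.a₂ * e ^ 2 + W.a₄ * e + W.a₆)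
    (h2 : 2 * f + W.a₁ * e + W.a₃ = 0) (ht : t = 3 * e ^ 2 + 2 * W.a₂ * e + W.a₄ - W.a₁ * f) :
    (y * (x - e) ^ 2 - t * (W.a₁ * (x - e) + y - f)) ^ 2 * (x - e) ^ 2 +
        W.a₁ * ((x - e) ^ 2 + e * (x - e) + t) * (y * (x - e) ^ 2 - t * (W.a₁ * (x - e) + y - f)) * (x - e) ^ 3 +
        W.a₃ * (y * (x - e) ^ 2 - t * (W.a₁ * (x - e) + y - f)) * (x - e) ^ 4 =
      ((x - e) ^ 2 + e * (x - e) + t) ^ 3 * (x - e) ^ 3 + W.a₂ * ((x - e) ^ 2 + e * (x - e) + t) ^ 2 * (x - e) ^ 4 +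
        (W.a₄ - 5 * t) * ((x - e) ^ 2 + e * (x - e) + t) * (x - e) ^ 5 +
        (W.a₆ - (W.a₁ ^ 2 + 4 * W.a₂) * t - 7 * e * t) * (x - e) ^ 6 := by
    linear_combination ((x - e) ^ 6 + (-2) * (x - e) ^ 4 * t + (x - e) ^ 2 * t ^ 2) * hW + (y * (x - e) ^ 4 * e * W.a₁ + (2) * y * (x - e) ^ 4 * f + y * (x - e) ^ 4 * W.a₃ + (-3) * y * (x - e) ^ 2 * e ^ 3 * W.a₁ + (-6) * y * (x - e) ^ 2 * e ^ 2 * f + (-2) * y * (x - e) ^ 2 * e ^ 2 * W.a₁ * W.a₂ + (-3) * y * (x - e) ^ 2 * e ^ 2 * W.a₃ + y * (x - e) ^ 2 * e * f * W.a₁ ^ 2 + (-4) * y * (x - e) ^ 2 * e * f * W.a₂ + -(y * (x - e) ^ 2 * e * t * W.a₁) + -(y * (x - e) ^ 2 * e * W.a₁ * W.a₄) + (-2) * y * (x - e) ^ 2 * e * W.a₂ * W.a₃ + (2) * y * (x - e) ^ 2 * f ^ 2 * W.a₁ + (-2) * y * (x - e) ^ 2 * f * t + y * (x - e) ^ 2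 * f * W.a₁ * W.a₃ + (-2) * y * (x - e) ^ 2 * f * W.a₄ + -(y * (x - e) ^ 2 * t * W.a₃) + -(y * (x - e) ^ 2 * W.a₃ * W.a₄) + -((x - e) ^ 5 * e * W.a₁ ^ 2) + (-2) * (x - e) ^ 5 * f * W.a₁ + (3) * (x - e) ^ 5 * t + -((x - e) ^ 5 * W.a₁ * W.a₃) + (-2) * (x - e) ^ 4 * e ^ 3 + (-2) * (x - e) ^ 4 * e ^ 2 * W.a₂ + (x - e) ^ 4 * e * f * W.a₁ + (-2) * (x - e) ^ 4 * e * W.a₄ + (x - e) ^ 4 * f * W.a₃ + (-2) * (x - e) ^ 4 * W.a₆ + -((x - e) ^ 3 * t ^ 2) + (3) * (x - e) ^ 2 * e ^ 5 + (5) * (x - e) ^ 2 * e ^ 4 * W.a₂ + -((x - e) ^ 2 * e ^ 3 * f * W.a₁) + (x - e) ^ 2 * e ^ 3 * t + (2) * (x - e) ^ 2 * e ^ 3 * W.a₂ ^ 2 + (4) * (x - e) ^ 2 * e ^ 3 * W.a₄ + (3) * (x - e) ^ 2 * e ^ 2 * f ^ 2 + -((x - e) ^ 2 * e ^ 2 *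 f * W.a₁ * W.a₂) + (x - e) ^ 2 * e ^ 2 * t * W.a₂ + (3) * (x - e) ^ 2 * e ^ 2 * W.a₂ * W.a₄ + (3) * (x - e) ^ 2 * e ^ 2 * W.a₆ + (2) * (x - e) ^ 2 * e * f ^ 2 * W.a₂ + -((x - e) ^ 2 * e * f * W.a₁ * W.a₄) + (x - e) ^ 2 * e * t * W.a₄ + (2) * (x - e) ^ 2 * e * W.a₂ * W.a₆ + (x - e) ^ 2 * e * W.a₄ ^ 2 + -((x - e) ^ 2 * f ^ 3 * W.a₁) + (x - e) ^ 2 * f ^ 2 * t + (x - e) ^ 2 * f ^ 2 * W.a₄ + -((x - e) ^ 2 * f * W.a₁ * W.a₆) + (x - e) ^ 2 * t * W.a₆ + (x - e) ^ 2 * W.a₄ * W.a₆) * ht + ((3) * y * (x - e) ^ 4 * e ^ 2 + (2) * y * (x - e) ^ 4 * e * W.a₂ + -(y * (x - e) ^ 4 * f * W.a₁) + y * (x - e) ^ 4 * W.a₄ + (-9) * y * (x - e) ^ 2 * e ^ 4 + (-12) * y * (x - e) ^ 2 * e ^ 3 * W.a₂ + (6) * y * (x - e) ^ 2 * e ^ 2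 * f * W.a₁ + (-4) * y * (x - e) ^ 2 * e ^ 2 * W.a₂ ^ 2 + (-6) * y * (x - e) ^ 2 * e ^ 2 * W.a₄ + (4) * y * (x - e) ^ 2 * e * f * W.a₁ * W.a₂ + (-4) * y * (x - e) ^ 2 * e * W.a₂ * W.a₄ + -(y * (x - e) ^ 2 * f ^ 2 * W.a₁ ^ 2) + (2) * y * (x - e) ^ 2 * f * W.a₁ * W.a₄ + -(y * (x - e) ^ 2 * W.a₄ ^ 2) + (-3) * (x - e) ^ 5 * e ^ 2 * W.a₁ + (-2) * (x - e) ^ 5 * e * W.a₁ * W.a₂ + (x - e) ^ 5 * f * W.a₁ ^ 2 + -((x - e) ^ 5 * W.a₁ * W.a₄) + (-3) * (x - e) ^ 4 * e ^ 2 * f + (-2) * (x - e) ^ 4 * e * f * W.a₂ + (x - e) ^ 4 * f ^ 2 * W.a₁ + -((x - e) ^ 4 * f * W.a₄) + (9) * (x - e) ^ 2 * e ^ 4 * f + (12) * (x - e) ^ 2 * e ^ 3 * f * W.a₂ + (-6) * (x - e) ^ 2 * e ^ 2 * f ^ 2 * W.a₁ + (4) * (x - e) ^ 2 * e ^ 2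 * f * W.a₂ ^ 2 + (6) * (x - e) ^ 2 * e ^ 2 * f * W.a₄ + (-4) * (x - e) ^ 2 * e * f ^ 2 * W.a₁ * W.a₂ + (4) * (x - e) ^ 2 * e * f * W.a₂ * W.a₄ + (x - e) ^ 2 * f ^ 3 * W.a₁ ^ 2 + (-2) * (x - e) ^ 2 * f ^ 2 * W.a₁ * W.a₄ + (x - e) ^ 2 * f * W.a₄ ^ 2) * h2 + ((6) * (x - e) ^ 4 * e ^ 2 + (4) * (x - e) ^ 4 * e * W.a₂ + (-2) * (x - e) ^ 4 * f * W.a₁ + (2) * (x - e) ^ 4 * W.a₄ + (-9) * (x - e) ^ 2 * e ^ 4 + (-12) * (x - e) ^ 2 * e ^ 3 * W.a₂ + (6) * (x - e) ^ 2 * e ^ 2 * f * W.a₁ + (-4) * (x - e) ^ 2 * e ^ 2 * W.a₂ ^ 2 + (-6) * (x - e) ^ 2 * e ^ 2 * W.a₄ + (4) * (x - e) ^ 2 * e * f * W.a₁ * W.a₂ + (-4) * (x - e) ^ 2 * e * W.a₂ * W.a₄ + -((x - e) ^ 2 * f ^ 2 * W.a₁ ^ 2) + (2) * (x - e) ^ 2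 * f * W.a₁ * W.a₄ + -((x - e) ^ 2 * W.a₄ ^ 2)) * hQ

/-- **Vélu's normalisation, the `y`-side**: `(x−e)²·(2y' + a₁x' + a₃) = ((x−e)² − t)·(2y + a₁x + a₃)`, i.e.
`2y' + a₁x' + a₃ = (1 − t/(x−e)²)(2y + a₁x + a₃)`; together with `dx' = (1 − t/(x−e)²)dx` this gives
`dx'/(2y' + a₁x' + a₃) = dx/(2y + a₁x + a₃)`. Only `2f + a₁e + a₃ = 0` is used. [cite: SilvermanAEC2009, III.4] -/
theorem velu_two_negY_cleared {x y e f t : R} (h2 : 2 * f + W.a₁ * e + W.a₃ = 0) :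
    2 * (y * (x - e) ^ 2 - t * (W.a₁ * (x - e) + y - f)) + W.a₁ * ((x - e) ^ 2 + e * (x - e) + t) * (x - e) +
        W.a₃ * (x - e) ^ 2 =
      ((x - e) ^ 2 - t) * (2 * y + W.a₁ * x + W.a₃) := by
  linear_combination t * h2

/-- **Vélu's `2`-isogeny on affine points (over a field, away from the kernel).** With `W'` any Weierstrass equation with
`A₁ = a₁, A₂ = a₂, A₃ = a₃, A₄ = a₄ − 5t, A₆ = a₆ − b₂t − 7et`: if `(x, y) ∈ W`, `x ≠ e`, then
`(x + t/(x − e), y − t(a₁(x − e) + y − f)/(x − e)²) ∈ W'`. [cite: SilvermanAEC2009, III.4 Example 4.5 and Exercise 3.35] -/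
theorem velu_two_equation {K : Type*} [Field K] (W W' : WeierstrassCurve K) {x y e f t : K}
    (hW : W.toAffine.Equation x y) (hQ : W.toAffine.Equation e f) (h2 : 2 * f + W.a₁ * e + W.a₃ = 0)
    (ht : t = 3 * e ^ 2 + 2 * W.a₂ * e + W.a₄ - W.a₁ * f) (hx : x ≠ e)
    (h1' : W'.a₁ = W.a₁) (h2' : W'.a₂ = W.a₂) (h3' : W'.a₃ = W.a₃) (h4' : W'.a₄ = W.a₄ - 5 * t)
    (h6' : W'.a₆ = W.a₆ - W.b₂ * t - 7 * e * t) :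
    W'.toAffine.Equation (x + t / (x - e)) (y - t * (W.a₁ * (x - e) + y - f) / (x - e) ^ 2) := by
  rw [WeierstrassCurve.Affine.equation_iff] at hW hQ ⊢
  have hD : x - e ≠ 0 := sub_ne_zero.mpr hx
  have hD2 : (x - e) ^ 2 ≠ 0 := pow_ne_zero 2 hD
  have key := velu_two_equation_cleared W hW hQ h2 ht
  have hX' : x + t / (x - e) = ((x - e) ^ 2 + e * (x - e) + t) / (x - e) := by
    rw [eq_div_iff hD, add_mul, div_mul_cancel₀ _ hD]; ring
  have hY' : y - t * (W.a₁ * (x - e) + y - f) / (x - e) ^ 2 =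
      (y * (x - e) ^ 2 - t * (W.a₁ * (x - e) + y - f)) / (x - e) ^ 2 := by
    rw [eq_div_iff hD2, sub_mul, div_mul_cancel₀ _ hD2]
  rw [hX', hY', h1', h2', h3', h4', h6', WeierstrassCurve.b₂, ← sub_eq_zero]
  set P₁ := (x - e) ^ 2 + e * (x - e) + t with hP₁
  set P₂ := y * (x - e) ^ 2 - t * (W.a₁ * (x - e) + y - f) with hP₂
  have hcl : (P₂ / (x - e) ^ 2) ^ 2 + W.a₁ * (P₁ / (x - e)) * (P₂ / (x - e) ^ 2) + W.a₃ * (P₂ / (x - e) ^ 2) -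
      ((P₁ / (x - e)) ^ 3 + W.a₂ * (P₁ / (x - e)) ^ 2 + (W.a₄ - 5 * t) * (P₁ / (x - e)) +
        (W.a₆ - (W.a₁ ^ 2 + 4 * W.a₂) * t - 7 * e * t)) =
      (P₂ ^ 2 * (x - e) ^ 2 + W.a₁ * P₁ * P₂ * (x - e) ^ 3 + W.a₃ * P₂ * (x - e) ^ 4 -
        (P₁ ^ 3 * (x - e) ^ 3 + W.a₂ * P₁ ^ 2 * (x - e) ^ 4 + (W.a₄ - 5 * t) * P₁ * (x - e) ^ 5 +
          (W.a₆ - (W.a₁ ^ 2 + 4 * W.a₂) * t - 7 * e * t) * (x - e) ^ 6)) / (x - e) ^ 6 := by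
    rw [eq_div_iff (pow_ne_zero 6 hD)]
    field_simp
  rw [hcl, sub_eq_zero.mpr key, zero_div]

end Summit.BirchSwinnertonDyer.BirchSwinnertonDyer.Theorems.AlignedTransportAtTwoSigmaSqTwo
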